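/-
Copyright (c) 2026 the pub-hodgecm-mathlib formalisation cell (harness21).  Prover seat hodgecm-mathlib-K2E3-p03 (g7), HCML Track B «K2-LIT» ∕ h413
(`stmt-HodgeConjecture-24833`), leaf (nsc-S-A′), brick WH0‴ of K2E3-p17 (g8)'s S4 census (C1″): THE `P₁₂`-STANDARD MODULE `D′(x, y) = Ind_{P₁₂}(x ⊠ y∘det₂)`
IS DEGENERATE — `Wh(D′(x,y)) = 0` (the `Q′`-mirror of ★ `K2E3GL3StandardModuleDegenerate`).  2026-09-04.
-/
import Summits.HodgeConjecture.HodgeConjecture.Theorems.K2E3GL3StandardModuleDegenerate          -- ★ WH0 (K2E3-p03 g6): the `P₂₁` twin (pattern); brings ★ STD-EMB, ★ WhittakerHeredityGL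
import Summits.HodgeConjecture.HodgeConjecture.Theorems.K2E3GL3OneTwoLeviBookkeeping             -- ★ (K2E3-p14): `monotone_oneTwo`, `det_leviProjection_oneTwo_false`
import Summits.HodgeConjecture.HodgeConjecture.Theorems.K2E3GL3CuspidalBlockRestriction           -- ★ `rootDeltaChar_eq_one_of_transvectionUnit`
import HarnessLib

/-!
# K2_E3 road (h413), leaf (nsc-S-A′), brick WH0‴ — the `P₁₂`-standard module `D′(x,y) = Ind_{P₁₂}((x ⊠ y∘det₂) δ^{1∕2})` has no Whittaker functional

Cell `pub/hodgecm-mathlib` (D-0151), Track B, seat K2E3-p03 (g7); FREE brick WH0‴ of K2E3-p17 (g8)'s S4 census v0.2 (K2 bus 2026-09-04 12:35:30Z), taken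
13:15Z.  `--supports stmt-HodgeConjecture-24833 --as helper`; THEOREMS ONLY; COUNT-NEUTRAL.

CURRENCY (the `Q′ = P₁₂` twin of ★ `K2E3GL3StandardModuleDegenerate`): `M_{Q′} := Π a : Bool, GL {i : Fin 3 // ![false,true,true] i = a} F` (block `false` = `{0}`,
block `true` = `{1,2}`), `ψ_{Q′} x y := (x ∘ det ∘ ev_false) · (y ∘ det ∘ ev_true)` (any characters `x`, `y` of `Fˣ`; for K2E3-p17's `D‴ = Ind_{Q′}(aν ⊗ η det₂)`:
`x = aν`, `y = η`), `σ_{Q′} := ((𝟙.twist ψ_{Q′}) ∘ proj_{Q′}) ⊗ δ_{Q′}^{1∕2}`, `D′ x y := parabolicIndGL F ![false,true,true] (𝟙.twist ψ_{Q′}) = Ind_{Q′} σ_{Q′}`;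
`ψ₀ : AddChar F Circle`, `ψ_U(u) = ψ₀(u₀₁ + u₁₂)`.

THE MATHEMATICS ([BernsteinZelevinskyASENS1977, §4.7, Thm. 5.2]; [Zelevinsky1980, §1, Ex. 3.2]; [Rodier1973]).  Rodier heredity (★
`exists_injective_whittakerFunctionals_smoothIndRep`) injects `Wh(Ind_{Q′} σ_{Q′})` into the Levi Whittaker functionals of `σ_{Q′}`: linear forms `l` on `ℂ` with
`l(σ_{Q′}(w₀ m w₀⁻¹) z) = ψ_U(m) l(z)` for `m ∈ A′ = U₃ ∩ P_{revLabel}`.  For `Q′` the root element is `m = u₀₁(y)`: `w₀ u₀₁(y) w₀⁻¹ = u₂₁(y)` is a unipotent of the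
Levi `GL₂`-block `{1,2}`, on which `σ_{Q′}` is trivial (both block determinants are `1` — the `{1,2}`-block of `u₂₁(y)` IS the transvection `1 + y E₂₁` — and
`δ_{Q′}^{1∕2} = 1`), while `ψ_U(u₀₁(y)) = ψ₀(y)`; choosing `y` with `ψ₀(y) ≠ 1` forces `l = 0`.  Hence `Wh(D′(x,y)) = 0` and `D′(x,y)` is NOT generic (★ HER: nor is
any subquotient).

§1 `permGL_rev_mul_transvectionUnit_zero_one_mul_inv`, `transvectionUnit_two_one_mem`, `transvectionUnit_zero_one_mem_cellLeviUnipotent`,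
`whittakerCharFun_transvectionUnit_zero_one`; §2 `coe_leviProjection_transvectionUnit_two_one_true`, `det_leviProjection_transvectionUnit_two_one_true ∕ _false`,
`sigmaQ'_transvectionUnit_two_one`; §3 **`leviWhittakerFunctionals_eq_bot`**; §4 **`whittakerFunctionals_eq_bot`**, **`not_isGeneric_D'`**.
HONEST LABEL: HC_CM is proved only modulo the 7 printed citations (2 remaining named inputs: hLiu418 = stmt-HodgeConjecture-24832, h413 =
stmt-HodgeConjecture-24833) until rung 0 closes; count-neutral helper.

## Mathlib ∕ tree search
★ `leviWhittakerFunctionals`, `mem_leviWhittakerFunctionals_iff`, `exists_injective_whittakerFunctionals_smoothIndRep`, `cellLeviUnipotent`, `mem_cellLeviUnipotent_iff_conj_mem`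
(WhittakerHeredityGL ∕ OpenBruhatCellGL); ★ `transvectionUnit_apply`, `coe_permGL_mul_mul_inv` (MaximalParabolicRelabel); ★ `det_leviProjection_oneTwo_false`, `monotone_oneTwo`
(OneTwoLeviBookkeeping); ★ `rootDeltaChar_eq_one_of_transvectionUnit` (CuspidalBlockRestriction); ★ `isOpen_ker_comp_det_eval`, `isOpen_ker_mul_of_isOpen` (STD-EMB); ★
`twist_comp_leviProjection_apply_eq_one` (G2); ★ `isSmooth_trivial_twist`; Mathlib `Matrix.det_transvection_of_ne`, `Matrix.transvection`.  Dedup: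
`rg "StandardModuleDegeneratePrime|not_isGeneric_D'"` — no hits.

References: [BernsteinZelevinskyASENS1977] Bernstein–Zelevinsky, *Induced representations of reductive 𝔭-adic groups I*, Ann. Sci. ÉNS 10 (1977),
§4.7, Thm. 5.2 · [Zelevinsky1980] Zelevinsky, *Induced representations II*, Ann. Sci. ÉNS 13 (1980), §1, Ex. 3.2 · [Rodier1973] F. Rodier, *Whittaker models
for admissible representations of reductive p-adic split groups*, Proc. Sympos. Pure Math. 26 (1973).
-/

set_option autoImplicit false
set_option linter.dupNamespace false

noncomputable section

open scoped MatrixGroups NNReal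
namespace Summit.HodgeConjecture.HodgeConjecture.Cruxes.H413.K2E3GL3StandardModuleDegeneratePrime

open ValuativeRel
open Literature.NumberTheory.Automorphic
open Literature.NumberTheory.GaloisRepresentations Literature.NumberTheory.GaloisRepresentations.IsNonarchimedeanLocalField
open K2E3GL3OneTwoLeviBookkeeping (monotone_oneTwo det_leviProjection_oneTwo_false)
open K2E3GL3StandardModuleEmbedding (isOpen_ker_comp_det_eval isOpen_ker_mul_of_isOpen)

/-! ## §1 The root element `u₀₁(y)` of `A′ = U₃ ∩ P_{revLabel}` and its conjugate `u₂₁(y)` -/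

section Root

variable {F : Type} [Field F]

/-- **`w₀ u₀₁(y) w₀⁻¹ = u₂₁(y)`** (the root group `(0,1) ⊂ U_{Q′}`'s complement goes to the LOWER root group `(2,1)` of the `GL₂`-block `{1,2}` of `P₁₂`).
[cite: BernsteinZelevinskyASENS1977, §4.7] -/
theorem permGL_rev_mul_transvectionUnit_zero_one_mul_inv (y : F) :
    (permGL Fin.revPerm : GL (Fin 3) F) * transvectionUnit 0 1 (by decide) y * (permGL Fin.revPerm)⁻¹ = transvectionUnit 2 1 (by decide) y := by
  apply Units.ext
  rw [coe_permGL_mul_mul_inv]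
  ext a b
  rw [Matrix.submatrix_apply, K2E3GL3MaximalParabolicRelabel.transvectionUnit_apply, K2E3GL3MaximalParabolicRelabel.transvectionUnit_apply]
  fin_cases a <;> fin_cases b <;> simp [Fin.revPerm_apply]

/-- `u₂₁(y) ∈ P₁₂` (it lies in the Levi `GL₂`-block `{1,2}`). [cite: BernsteinZelevinsky1977, §2.1] -/
theorem transvectionUnit_two_one_mem (y : F) :
    transvectionUnit (n := 3) 2 1 (by decide) y ∈ standardParabolicGL F (![false, true, true] : Fin 3 → Bool) := by
  rw [mem_standardParabolicGL_iff]
  intro i j hij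
  have hne : i ≠ j := by rintro rfl; exact lt_irrefl _ hij
  rw [K2E3GL3MaximalParabolicRelabel.transvectionUnit_apply, Matrix.one_apply_ne hne, zero_add, if_neg]
  rintro ⟨rfl, rfl⟩
  revert hij
  decide

/-- `u₀₁(y) ∈ A′ = U₃ ⊓ P_{revLabel ![false,true,true]}` (upper unitriangular, and `w₀ u₀₁(y) w₀⁻¹ = u₂₁(y) ∈ P₁₂`). [cite: BernsteinZelevinskyASENS1977, §4.7] -/
theorem transvectionUnit_zero_one_mem_cellLeviUnipotent (y : F) :
    transvectionUnit (n := 3) 0 1 (by decide) y ∈ cellLeviUnipotent (K := F) (![false, true, true] : Fin 3 → Bool) := by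
  rw [mem_cellLeviUnipotent_iff_conj_mem]
  refine ⟨transvectionUnit_mem_upperUnitriangular (by decide) y, ?_⟩
  rw [permGL_rev_mul_transvectionUnit_zero_one_mul_inv]
  exact transvectionUnit_two_one_mem y

/-- **`ψ_U(u₀₁(y)) = ψ₀(y)`**: the non-degenerate character `ψ_U(u) = ψ₀(u₀₁ + u₁₂)` on the root element `u₀₁(y)`. [cite: BernsteinZelevinskyASENS1977, §4.7] -/
theorem whittakerCharFun_transvectionUnit_zero_one (ψ₀ : AddChar F Circle) (y : F)
    (h : transvectionUnit (n := 3) 0 1 (by decide) y ∈ upperUnitriangular (Fin 3) F) :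
    whittakerCharFun ψ₀ ⟨transvectionUnit (n := 3) 0 1 (by decide) y, h⟩ = ψ₀ y := by
  have hsum : superdiagSum (⟨transvectionUnit (n := 3) 0 1 (by decide) y, h⟩ : ↥(upperUnitriangular (Fin 3) F)) = y := by
    rw [superdiagSum_def]
    simp only [Fin.sum_univ_three, Fin.val_zero, Fin.val_one, Fin.val_two, K2E3GL3MaximalParabolicRelabel.transvectionUnit_apply]
    norm_num
    all_goals simp [Matrix.one_apply_ne]
  rw [whittakerCharFun_apply, hsum]

end Root

/-! ## §2 The inducing datum `σ_{Q′}` is trivial on `u₂₁(y)` -/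

section Sigma

variable {F : Type} [Field F]

/-- **The `GL₂`-block of `u₂₁(y) ∈ P₁₂` is the transvection `1 + y E₂₁`** of the index type `{i // ![false,true,true] i = true} = {1,2}`. [cite: BernsteinZelevinsky1977, §2.1] -/
theorem coe_leviProjection_transvectionUnit_two_one_true (y : F) :
    ((leviProjection F (![false, true, true] : Fin 3 → Bool) ⟨transvectionUnit (n := 3) 2 1 (by decide) y, transvectionUnit_two_one_mem y⟩ true :
        GL {i : Fin 3 // (![false, true, true] : Fin 3 → Bool) i = true} F) : Matrix _ _ F) =
      Matrix.transvection (⟨2, rfl⟩ : {i : Fin 3 // (![false, true, true] : Fin 3 → Bool) i = true}) ⟨1, rfl⟩ y := by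
  ext ⟨i, hi⟩ ⟨j, hj⟩
  rw [leviProjection_apply_coe, Subgroup.coe_mk, K2E3GL3MaximalParabolicRelabel.transvectionUnit_apply, Matrix.transvection, Matrix.add_apply,
    Matrix.single_apply]
  have h1 : (1 : Matrix (Fin 3) (Fin 3) F) i j =
      (1 : Matrix {i : Fin 3 // (![false, true, true] : Fin 3 → Bool) i = true} {i : Fin 3 // (![false, true, true] : Fin 3 → Bool) i = true} F) ⟨i, hi⟩ ⟨j, hj⟩ := by
    by_cases hij : i = j
    · subst hij; rw [Matrix.one_apply_eq, Matrix.one_apply_eq]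
    · rw [Matrix.one_apply_ne hij, Matrix.one_apply_ne (fun h => hij (congrArg Subtype.val h))]
  rw [h1]
  congr 1
  exact if_congr (by simp only [Subtype.mk.injEq]; exact ⟨fun h => ⟨h.1.symm, h.2.symm⟩, fun h => ⟨h.1.symm, h.2.symm⟩⟩) rfl rfl

/-- The `GL₂`-block of `u₂₁(y)` has determinant `1`. [cite: BernsteinZelevinsky1977, §2.1] -/
theorem det_leviProjection_transvectionUnit_two_one_true (y : F) :
    Matrix.GeneralLinearGroup.det (leviProjection F (![false, true, true] : Fin 3 → Bool) ⟨transvectionUnit (n := 3) 2 1 (by decide) y,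
      transvectionUnit_two_one_mem y⟩ true) = 1 :=
  Units.ext (by rw [Matrix.GeneralLinearGroup.val_det_apply, coe_leviProjection_transvectionUnit_two_one_true, Matrix.det_transvection_of_ne _ _ (by decide), Units.val_one])

/-- The `GL₁`-block of `u₂₁(y)` has determinant `1` (its entry `(0,0)`). [cite: BernsteinZelevinsky1977, §2.1] -/
theorem det_leviProjection_transvectionUnit_two_one_false (y : F) :
    Matrix.GeneralLinearGroup.det (leviProjection F (![false, true, true] : Fin 3 → Bool) ⟨transvectionUnit (n := 3) 2 1 (by decide) y,
      transvectionUnit_two_one_mem y⟩ false) = 1 := by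
  apply Units.ext
  rw [det_leviProjection_oneTwo_false, Units.val_one]
  change ((transvectionUnit (n := 3) 2 1 (by decide) y : GL (Fin 3) F) : Matrix (Fin 3) (Fin 3) F) 0 0 = 1
  rw [K2E3GL3MaximalParabolicRelabel.transvectionUnit_apply, Matrix.one_apply_eq, if_neg (by decide), add_zero]

variable [ValuativeRel F] [TopologicalSpace F] [IsNonarchimedeanLocalField F] (x y : Fˣ →* ℂˣ)

/-- **`σ_{Q′}(u₂₁(t)) = 1`** for the inducing datum `σ_{Q′} = ((𝟙.twist ψ_{Q′}) ∘ proj_{Q′}) ⊗ δ_{Q′}^{1∕2}` of `D′(x,y)`: both block determinants of `u₂₁(t)` are `1`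
and `δ_{Q′}^{1∕2}(u₂₁(t)) = 1` (★ `rootDeltaChar_eq_one_of_transvectionUnit`). [cite: BernsteinZelevinsky1977, 1.7, §2.3] -/
theorem sigmaQ'_transvectionUnit_two_one (t : F) :
    (Representation.twist (((Representation.trivial ℂ (Π a : Bool, GL {i : Fin 3 // (![false, true, true] : Fin 3 → Bool) i = a} F) ℂ).twist
        ((x.comp (Matrix.GeneralLinearGroup.det.comp (Pi.evalMonoidHom (fun a : Bool => GL {i : Fin 3 // (![false, true, true] : Fin 3 → Bool) i = a} F) false))) *
          (y.comp (Matrix.GeneralLinearGroup.det.comp (Pi.evalMonoidHom (fun a : Bool => GL {i : Fin 3 // (![false, true, true] : Fin 3 → Bool) i = a} F) true))))).comp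
        (leviProjection F (![false, true, true] : Fin 3 → Bool))) (rootDeltaChar (standardParabolicGL F (![false, true, true] : Fin 3 → Bool))))
        ⟨transvectionUnit (n := 3) 2 1 (by decide) t, transvectionUnit_two_one_mem t⟩ = 1 := by
  haveI : IsTopologicalRing F := inferInstance
  have hδ := K2E3GL3CuspidalBlockRestriction.rootDeltaChar_eq_one_of_transvectionUnit F (P := (standardParabolicGL F (![false, true, true] : Fin 3 → Bool)))
    (i := 2) (j := 1) (by decide) (fun z => transvectionUnit_two_one_mem z) t
  apply LinearMap.ext
  intro z
  simp only [Representation.twist_apply, MonoidHom.coe_comp, Function.comp_apply, Representation.trivial_apply, MonoidHom.mul_apply,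
    Pi.evalMonoidHom_apply, hδ, det_leviProjection_transvectionUnit_two_one_true, det_leviProjection_transvectionUnit_two_one_false, map_one, one_mul,
    Units.val_one, one_smul, Module.End.one_apply]

/-! ## §3 The Levi Whittaker functionals of `σ_{Q′}` vanish -/

/-- **`leviWhittakerFunctionals(σ_{Q′}, ψ₀) = 0`** for `ψ₀ ≠ 0`: a Levi Whittaker functional `l` satisfies `l(σ_{Q′}(w₀ m w₀⁻¹) z) = ψ_U(m) l(z)` for `m ∈ A′`; with
`m = u₀₁(t)`, `σ_{Q′}(w₀ u₀₁(t) w₀⁻¹) = σ_{Q′}(u₂₁(t)) = 1` (§2) and `ψ_U(u₀₁(t)) = ψ₀(t) ≠ 1` for a suitable `t`, so `l = 0`.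
[cite: BernsteinZelevinskyASENS1977, §4.7, Thm. 5.2] [cite: Zelevinsky1980, Ex. 3.2] -/
theorem leviWhittakerFunctionals_eq_bot {ψ₀ : AddChar F Circle} (hψ₀ : ψ₀ ≠ 0) :
    leviWhittakerFunctionals (![false, true, true] : Fin 3 → Bool)
        (Representation.twist (((Representation.trivial ℂ (Π a : Bool, GL {i : Fin 3 // (![false, true, true] : Fin 3 → Bool) i = a} F) ℂ).twist
          ((x.comp (Matrix.GeneralLinearGroup.det.comp (Pi.evalMonoidHom (fun a : Bool => GL {i : Fin 3 // (![false, true, true] : Fin 3 → Bool) i = a} F) false))) *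
            (y.comp (Matrix.GeneralLinearGroup.det.comp (Pi.evalMonoidHom (fun a : Bool => GL {i : Fin 3 // (![false, true, true] : Fin 3 → Bool) i = a} F) true))))).comp
          (leviProjection F (![false, true, true] : Fin 3 → Bool))) (rootDeltaChar (standardParabolicGL F (![false, true, true] : Fin 3 → Bool)))) ψ₀ = ⊥ := by
  obtain ⟨t, ht⟩ := AddChar.ne_zero_iff.1 hψ₀
  have ht' : ((ψ₀ t : Circle) : ℂ) ≠ 1 := fun h => ht (Circle.coe_eq_one.1 h)
  have hconj : (⟨permGL Fin.revPerm * transvectionUnit (n := 3) 0 1 (by decide) t * (permGL Fin.revPerm)⁻¹,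
      conj_mem_standardParabolicGL_of_mem_cellLeviUnipotent (![false, true, true] : Fin 3 → Bool)
        (transvectionUnit_zero_one_mem_cellLeviUnipotent t)⟩ : ↥(standardParabolicGL F (![false, true, true] : Fin 3 → Bool))) =
      ⟨transvectionUnit (n := 3) 2 1 (by decide) t, transvectionUnit_two_one_mem t⟩ :=
    Subtype.ext (permGL_rev_mul_transvectionUnit_zero_one_mul_inv t)
  rw [Submodule.eq_bot_iff]
  intro l hl
  apply LinearMap.ext
  intro z
  have h := (mem_leviWhittakerFunctionals_iff _ _ ψ₀ l).1 hl _ (transvectionUnit_zero_one_mem_cellLeviUnipotent t) z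
  rw [hconj, sigmaQ'_transvectionUnit_two_one, Module.End.one_apply,
    whittakerCharFun_transvectionUnit_zero_one ψ₀ t (transvectionUnit_mem_upperUnitriangular (by decide) t)] at h
  rw [LinearMap.zero_apply]
  rcases mul_right_eq_self₀.1 ((mul_comm _ _).trans h.symm) with h1 | h0
  · exact absurd h1 ht'
  · exact h0

/-! ## §4 `Wh(D′(x,y)) = 0`: the `P₁₂`-standard module is degenerate -/

/-- `ψ_{Q′} = (x ∘ det ∘ ev_false)·(y ∘ det ∘ ev_true)` has open kernel when `x`, `y` do. [folklore] -/
theorem isOpen_ker_psiQ' (hx : IsOpen ((x.ker : Subgroup Fˣ) : Set Fˣ)) (hy : IsOpen ((y.ker : Subgroup Fˣ) : Set Fˣ)) :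
    IsOpen ((((x.comp (Matrix.GeneralLinearGroup.det.comp (Pi.evalMonoidHom (fun a : Bool => GL {i : Fin 3 // (![false, true, true] : Fin 3 → Bool) i = a} F) false))) *
      (y.comp (Matrix.GeneralLinearGroup.det.comp (Pi.evalMonoidHom (fun a : Bool => GL {i : Fin 3 // (![false, true, true] : Fin 3 → Bool) i = a} F) true)))).ker :
        Subgroup (Π a : Bool, GL {i : Fin 3 // (![false, true, true] : Fin 3 → Bool) i = a} F)) : Set (Π a : Bool, GL {i : Fin 3 // (![false, true, true] : Fin 3 → Bool) i = a} F)) :=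
  isOpen_ker_mul_of_isOpen (isOpen_ker_comp_det_eval x hx false) (isOpen_ker_comp_det_eval y hy true)

/-- **`Wh(D′(x,y), ψ₀) = 0`** for `ker x`, `ker y` open and `ψ₀` continuous non-trivial: Rodier heredity (★ `exists_injective_whittakerFunctionals_smoothIndRep`, the
inducing datum being smooth and trivial on `U_{Q′}`, ★ `twist_comp_leviProjection_apply_eq_one`) injects `Wh(Ind_{Q′} σ_{Q′})` into `leviWhittakerFunctionals(σ_{Q′}) = 0` (§3).
[cite: BernsteinZelevinskyASENS1977, Thm. 5.2, §4.7] [cite: Zelevinsky1980, Ex. 3.2] -/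
theorem whittakerFunctionals_eq_bot (hx : IsOpen ((x.ker : Subgroup Fˣ) : Set Fˣ)) (hy : IsOpen ((y.ker : Subgroup Fˣ) : Set Fˣ))
    {ψ₀ : AddChar F Circle} (hψ₀ : ψ₀.IsContinuousNontrivial) :
    whittakerFunctionals (Representation.parabolicIndGL F (![false, true, true] : Fin 3 → Bool)
      ((Representation.trivial ℂ (Π a : Bool, GL {i : Fin 3 // (![false, true, true] : Fin 3 → Bool) i = a} F) ℂ).twist
        ((x.comp (Matrix.GeneralLinearGroup.det.comp (Pi.evalMonoidHom (fun a : Bool => GL {i : Fin 3 // (![false, true, true] : Fin 3 → Bool) i = a} F) false))) *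
          (y.comp (Matrix.GeneralLinearGroup.det.comp (Pi.evalMonoidHom (fun a : Bool => GL {i : Fin 3 // (![false, true, true] : Fin 3 → Bool) i = a} F) true)))))) ψ₀ = ⊥ := by
  have hσ : ((Representation.trivial ℂ (Π a : Bool, GL {i : Fin 3 // (![false, true, true] : Fin 3 → Bool) i = a} F) ℂ).twist
      ((x.comp (Matrix.GeneralLinearGroup.det.comp (Pi.evalMonoidHom (fun a : Bool => GL {i : Fin 3 // (![false, true, true] : Fin 3 → Bool) i = a} F) false))) *
        (y.comp (Matrix.GeneralLinearGroup.det.comp (Pi.evalMonoidHom (fun a : Bool => GL {i : Fin 3 // (![false, true, true] : Fin 3 → Bool) i = a} F) true))))).IsSmooth :=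
    isSmooth_trivial_twist (isOpen_ker_psiQ' x y hx hy)
  obtain ⟨Λ, hΛ⟩ := exists_injective_whittakerFunctionals_smoothIndRep (F := F) (c := (![false, true, true] : Fin 3 → Bool))
    (σ' := (Representation.twist (((Representation.trivial ℂ (Π a : Bool, GL {i : Fin 3 // (![false, true, true] : Fin 3 → Bool) i = a} F) ℂ).twist
      ((x.comp (Matrix.GeneralLinearGroup.det.comp (Pi.evalMonoidHom (fun a : Bool => GL {i : Fin 3 // (![false, true, true] : Fin 3 → Bool) i = a} F) false))) *
        (y.comp (Matrix.GeneralLinearGroup.det.comp (Pi.evalMonoidHom (fun a : Bool => GL {i : Fin 3 // (![false, true, true] : Fin 3 → Bool) i = a} F) true))))).comp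
      (leviProjection F (![false, true, true] : Fin 3 → Bool))) (rootDeltaChar (standardParabolicGL F (![false, true, true] : Fin 3 → Bool))))) ψ₀ monotone_oneTwo
    hσ.twist_comp_leviProjection
    (fun p hp => K2E3GL2ReducibleInducedDetCharConstituent.twist_comp_leviProjection_apply_eq_one (![false, true, true] : Fin 3 → Bool) _ p hp) hψ₀
  rw [Submodule.eq_bot_iff]
  intro l hl
  have h1 : Λ ⟨l, hl⟩ = 0 :=
    Subtype.ext ((Submodule.eq_bot_iff _).1 (leviWhittakerFunctionals_eq_bot x y hψ₀.2) _ (Λ ⟨l, hl⟩).2)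
  have h2 : (⟨l, hl⟩ : ↥(whittakerFunctionals (Representation.parabolicIndGL F (![false, true, true] : Fin 3 → Bool)
      ((Representation.trivial ℂ (Π a : Bool, GL {i : Fin 3 // (![false, true, true] : Fin 3 → Bool) i = a} F) ℂ).twist
        ((x.comp (Matrix.GeneralLinearGroup.det.comp (Pi.evalMonoidHom (fun a : Bool => GL {i : Fin 3 // (![false, true, true] : Fin 3 → Bool) i = a} F) false))) *
          (y.comp (Matrix.GeneralLinearGroup.det.comp (Pi.evalMonoidHom (fun a : Bool => GL {i : Fin 3 // (![false, true, true] : Fin 3 → Bool) i = a} F) true)))))) ψ₀)) = 0 :=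
    hΛ (h1.trans (map_zero Λ).symm)
  exact congrArg Subtype.val h2

/-- **BRICK WH0‴ — `D′(x,y) = Ind_{P₁₂}(x ⊠ y∘det₂)` IS NOT GENERIC** (`¬ IsGeneric (D′ x y) ψ₀`, i.e. `Wh(D′(x,y), ψ₀) = 0`), for characters `x, y` with open kernels and
`ψ₀` continuous non-trivial (K2E3-p17 (g8)'s `D‴ = Ind_{Q′}(aν ⊗ ηdet₂)` is `x = aν`, `y = η`).  With ★ HER no subquotient of `D′(x,y)` is generic either.
[cite: BernsteinZelevinskyASENS1977, Thm. 5.2, §4.7] [cite: Zelevinsky1980, §1, Ex. 3.2] -/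
theorem not_isGeneric_D' (hx : IsOpen ((x.ker : Subgroup Fˣ) : Set Fˣ)) (hy : IsOpen ((y.ker : Subgroup Fˣ) : Set Fˣ))
    (ψ₀ : AddChar F Circle) (hψ₀ : ψ₀.IsContinuousNontrivial) :
    ¬ IsGeneric (Representation.parabolicIndGL F (![false, true, true] : Fin 3 → Bool)
      ((Representation.trivial ℂ (Π a : Bool, GL {i : Fin 3 // (![false, true, true] : Fin 3 → Bool) i = a} F) ℂ).twist
        ((x.comp (Matrix.GeneralLinearGroup.det.comp (Pi.evalMonoidHom (fun a : Bool => GL {i : Fin 3 // (![false, true, true] : Fin 3 → Bool) i = a} F) false))) *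
          (y.comp (Matrix.GeneralLinearGroup.det.comp (Pi.evalMonoidHom (fun a : Bool => GL {i : Fin 3 // (![false, true, true] : Fin 3 → Bool) i = a} F) true)))))) ψ₀ :=
  fun h => h (whittakerFunctionals_eq_bot x y hx hy hψ₀)

end Sigma

end Summit.HodgeConjecture.HodgeConjecture.Cruxes.H413.K2E3GL3StandardModuleDegeneratePrime

end
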